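import Literature.NumberTheory.PAdicHodge.BdRPlusLogLatticeMul
import Literature.NumberTheory.PAdicHodge.BdRPlusLogLatticeTheta
import Literature.NumberTheory.PAdicHodge.TiltUntiltKernel
import Literature.NumberTheory.PAdicHodge.CompletedAlgClosureAlgClosed
import HarnessLib

/-!
# `log[x] mod Fil^k`: the kernel of `θ` is `ℚ_p · t`, and `θ` is onto `ℂ_F` (generator level of `0 → ℚ_p(1) → X → ℂ_F → 0`)

Topic `Literature/NumberTheory/PAdicHodge`; namespace `Literature.NumberTheory.PAdicHodge.GaloisContinuity`. THEOREMS ONLY (no definition,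
no instance, no named fact, no `sorry`). Sequel of `BdRPlusLogLattice` (`IsLogModFil`), `BdRPlusLogLatticeMul` (additivity, powers),
`BdRPlusLogLatticeTheta` (`θ(log(1+y)) = log_p(θ(1+y))`), `BdRPlusLogOneAdd` (`log[ε^a] = a·t`), `TiltUntiltKernel` (`ker ♯ = ε^{ℤ_p}`),
`CompletedAlgClosurePadicNorm` (`ker log|_{1+𝔪_ℂ} ⊆ μ_{p^∞}`, `log` onto a ball) and `CompletedAlgClosureAlgClosed` (`♯` onto). For Teichmüller
arguments `1 + y = [x]`, `x ∈ 𝒪_{ℂ_F}♭` with `[x] − 1 ∈ (p, ξ)𝔸_inf` (⟺ `‖x♯ − 1‖ ≤ ‖p‖`, §1), the logarithms `L = log[x] mod Fil^k` satisfy: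

* §1 `teichmuller_sub_one_mem_span_p_xi_iff` — `[x] − 1 ∈ (p, ξ) ↔ ‖x♯ − 1‖ ≤ ‖p‖`; `isLogModFil_uAinf_tBdR` — Fontaine's `t` IS a
  logarithm of `[ε]` modulo every `Fil^k` (`t ∈ X`); `isLogModFil_teichmuller_epsPow` — `a·t` is one of `[ε^a]`, `a ∈ ℤ_p`.
* §2 ★★ `IsLogModFil.exists_pow_mul_sub_mul_tBdR_mem` — **the kernel of `θ` on `X` is `ℚ_p·t`**: if `θ(L) = 0` then
  `p^N · L − a · t ∈ ξ^k B_dR⁺` for some `N ∈ ℕ`, `a ∈ ℤ_p` (chain: `log_p(x♯) = 0` ⟹ `(x♯)^{p^N} = 1` ⟹ `x^{p^N} = ε^a` ⟹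
  `p^N·L ≡ log[ε^a] = a·t`).
* §3 ★★ `exists_isLogModFil_thetaBdR_eq_pow_mul` — **`θ` maps `X` onto `ℂ_F` up to `p`-powers**: every `c ∈ ℂ_F` has `p^N c = θ(L)` for
  a logarithm `L` of some `[x]` with `[x] − 1 ∈ (p, ξ)` (`log` is onto a ball of `ℂ_F`, `♯` is onto `𝒪_{ℂ_F}`, and the `p^M`-power trick
  `‖1 − u^{p^M}‖ ≤ ‖p‖`).

This is floor (H4)-2 of `Summits/…/Cruxes/StarredOptimalManinUnitFiveSeven/Lines/kato-lever-K3-B2-road.md` (crux K★ `stmt-BirchSwinnertonDyer-22226`)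
at the level of generators: with `X₂ := ℚ_p · {log[x] mod Fil²}` it gives `X₂ ∩ Fil¹B₂ = ℚ_p t` and `θ(X₂) = ℂ_F` once `X₂` is known to be
a `ℚ_p`-line of single logarithms (`BdRPlusLogLatticeMul` + `ℤ_p`-powers, not here). Infrastructure only; BSD / K★ are not proved by any of this.

## References
* J.-M. Fontaine, *Le corps des périodes p-adiques*, Astérisque 223 (1994), Exp. II §1.2.2–1.2.3, §1.5.2–1.5.4. [FontaineAsterisque223III]
* J.-M. Fontaine, Y. Ouyang, *Theory of p-adic Galois representations*, §6.1 (`U → B_crys^{φ=p}`, `θ(log[x]) = log x^{(0)}`,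
  the fundamental exact sequence). [FontaineOuyang2022]
-/

noncomputable section

namespace Literature.NumberTheory.PAdicHodge

namespace GaloisContinuity

open ValuativeRel Field Ideal WittVector Finset Filter TruncatedLog
open _root_.Topology
open Literature.NumberTheory.GaloisRepresentations Literature.NumberTheory.GaloisRepresentations.IsNonarchimedeanLocalField
open Literature.IUT.LogVolume

variable {F : Type} [Field F] [ValuativeRel F] [TopologicalSpace F] [IsNonarchimedeanLocalField F]
  [CharZero F] {p : ℕ} [Fact p.Prime] [Fact (¬ IsUnit (p : integerC F))]
  [IsAdicComplete (Ideal.span {(p : integerC F)}) (integerC F)]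

/-! ## §1 Teichmüller arguments; `t` and `a·t` are logarithms of `[ε]`, `[ε^a]` -/

/-- `θ(ι[x]) = x♯` in `ℂ_F`. [cite: FontaineAsterisque223III, Exp. II §1.2.2] -/
theorem thetaBdR_ainfToBdR_teichmuller (x : PreTilt (integerC F) p) :
    thetaBdR (ainfToBdR (teichmuller p x : Ainf (p := p) F)) = ((PreTilt.untilt x : integerC F) : CompletedAlgClosure F) := by
  rw [thetaBdR_ainfToBdR, fontaineTheta_teichmuller]

/-- **`[x] − 1 ∈ (p, ξ)𝔸_inf ↔ ‖x♯ − 1‖ ≤ ‖p‖`** (`(p, ξ) = θ⁻¹(p 𝒪_{ℂ_F})`, `♯` onto `𝒪_{ℂ_F}`): the arguments `x ∈ 1 + p♭𝒪_{ℂ_F}♭` of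
Fontaine's `p`-adic logarithm. [cite: FontaineAsterisque223III, Exp. II §1.2.2–1.2.3] -/
theorem teichmuller_sub_one_mem_span_p_xi_iff (x : PreTilt (integerC F) p) :
    (teichmuller p x : Ainf (p := p) F) - 1 ∈ Ideal.span {(p : Ainf (p := p) F), xi} ↔
      ‖((PreTilt.untilt x : integerC F) : CompletedAlgClosure F) - 1‖ ≤ ‖(p : CompletedAlgClosure F)‖ := by
  constructor
  · intro h
    obtain ⟨a, b, hab⟩ := Ideal.mem_span_pair.1 h
    have e : ((PreTilt.untilt x : integerC F) : CompletedAlgClosure F) - 1 =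
        thetaBdR (ainfToBdR ((teichmuller p x : Ainf (p := p) F) - 1)) := by
      rw [map_sub, map_one, map_sub, map_one, thetaBdR_ainfToBdR_teichmuller]
    rw [e, ← hab]
    simp only [map_add, map_mul, map_natCast, ainfToBdR_xi, thetaBdR_xiBdR, mul_zero, add_zero, thetaBdR_ainfToBdR, norm_mul]
    exact mul_le_of_le_one_left (norm_nonneg _) (norm_coe_integerC_le _)
  · intro h
    haveI : CharZero (CompletedAlgClosure F) := charZero_of_injective_algebraMap (algebraMap F (CompletedAlgClosure F)).injective
    have hp0 : (p : CompletedAlgClosure F) ≠ 0 := Nat.cast_ne_zero.2 (Fact.out : p.Prime).ne_zero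
    -- `x♯ − 1 = p · c` with `c ∈ 𝒪_{ℂ_F}`, `c = z♯`
    have hc : ‖(((PreTilt.untilt x : integerC F) : CompletedAlgClosure F) - 1) / (p : CompletedAlgClosure F)‖ ≤ 1 := by
      rw [norm_div, div_le_one (norm_pos_iff.2 hp0)]; exact h
    obtain ⟨z, hz⟩ := CompletedAlgClosure.exists_untilt_coe_eq (F := F) (p := p) hc
    have hθ : fontaineTheta (integerC F) p ((teichmuller p x : Ainf (p := p) F) - 1 - (p : Ainf (p := p) F) * teichmuller p z) = 0 := by
      refine Subtype.ext ?_
      have e := congrArg (fun w => (p : CompletedAlgClosure F) * w) hz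
      simp only [mul_div_cancel₀ _ hp0] at e
      rw [map_sub, map_sub, map_mul, map_one, map_natCast, fontaineTheta_teichmuller, fontaineTheta_teichmuller]
      push_cast
      rw [e, sub_self]
    have hker : (teichmuller p x : Ainf (p := p) F) - 1 - (p : Ainf (p := p) F) * teichmuller p z ∈
        Ideal.span {(xi : Ainf (p := p) F)} := by
      rw [← ker_fontaineTheta_eq_span_xi]; exact hθ
    obtain ⟨b, hb⟩ := Ideal.mem_span_singleton'.1 hker
    exact Ideal.mem_span_pair.2 ⟨teichmuller p z, b, by rw [hb]; ring⟩

/-- `[ε^a] − 1 ∈ (p, ξ)𝔸_inf` (indeed `∈ ξ𝔸_inf`: `θ[ε^a] = 1`). [cite: FontaineAsterisque223III, Exp. II §1.5.4] -/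
theorem teichmuller_epsPow_sub_one_mem_span_p_xi (a : ℤ_[p]) :
    (teichmuller p (epsPow a : PreTilt (integerC F) p) : Ainf (p := p) F) - 1 ∈ Ideal.span {(p : Ainf (p := p) F), xi} :=
  Ideal.span_mono (Set.subset_insert _ _) (Ideal.mem_span_singleton.2 (xi_dvd_teichmuller_epsPow_sub_one a))

/-- ★ **`a · t` is a logarithm of `[ε^a]` modulo every `Fil^k`** (`a ∈ ℤ_p`; `log[ε^a] = a·t` `ξ`-adically, `BdRPlusTop.logOneAdd_teichmuller_epsPow`,
and the `ξ`-adic logarithm is a `p`-adic one, `isLogModFil_logOneAdd`). [cite: FontaineAsterisque223III, Exp. II §1.5.4] -/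
theorem isLogModFil_teichmuller_epsPow (k : ℕ) (a : ℤ_[p]) :
    IsLogModFil k ((teichmuller p (epsPow a : PreTilt (integerC F) p) : Ainf (p := p) F) - 1) (qpToBdR (a : ℚ_[p]) * tBdR) := by
  have hy : (teichmuller p (epsPow a : PreTilt (integerC F) p) : Ainf (p := p) F) - 1 ∈ Ideal.span {(xi : Ainf (p := p) F)} :=
    Ideal.mem_span_singleton.2 (xi_dvd_teichmuller_epsPow_sub_one a)
  have h := isLogModFil_logOneAdd k hy
  have e : (⟨BdRPlusTop.ofAinf F p ((teichmuller p (epsPow a : PreTilt (integerC F) p) : Ainf (p := p) F) - 1),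
      BdRPlusTop.ofAinf_mem_filOne hy⟩ : (BdRPlusTop.filOne F p).toIdeal) =
      ⟨BdRPlusTop.ofAinf F p (teichmuller p (epsPow a : PreTilt (integerC F) p)) - 1,
        BdRPlusTop.ofAinf_teichmuller_epsPow_sub_one_mem_filOne a⟩ := Subtype.ext (by
    change BdRPlusTop.ofAinf F p ((teichmuller p (epsPow a : PreTilt (integerC F) p) : Ainf (p := p) F) - 1) =
      BdRPlusTop.ofAinf F p (teichmuller p (epsPow a : PreTilt (integerC F) p)) - 1
    rw [map_sub, map_one])
  rwa [e, BdRPlusTop.logOneAdd_teichmuller_epsPow, RingEquiv.symm_apply_apply] at h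

/-- ★ **Fontaine's `t` is a logarithm of `[ε] = 1 + u` modulo every `Fil^k`**: `IsLogModFil k u t` (`u = [ε] − 1`): `ℚ_p(1) = ℚ_p·t ⊂ X`.
[cite: FontaineAsterisque223III, Exp. II §1.5.4] -/
theorem isLogModFil_uAinf_tBdR (k : ℕ) : IsLogModFil k (uAinf : Ainf (p := p) F) tBdR := by
  have h := isLogModFil_teichmuller_epsPow (F := F) (p := p) k 1
  rwa [epsPow_one, ← uAinf_def, PadicInt.coe_one, map_one, one_mul] at h

/-- `u = [ε] − 1 ∈ (p, ξ)𝔸_inf`. [cite: FontaineAsterisque223III, Exp. II §1.5.4] -/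
theorem uAinf_mem_span_p_xi : (uAinf : Ainf (p := p) F) ∈ Ideal.span {(p : Ainf (p := p) F), xi} := by
  rw [uAinf_def, ← epsPow_one]; exact teichmuller_epsPow_sub_one_mem_span_p_xi 1

/-! ## §2 The kernel of `θ` on the logarithms is `ℚ_p · t` -/

/-- ★★ **`θ(log[x]) = 0 ⟹ p^N log[x] ≡ a·t (mod Fil^k)`.** For `x ∈ 𝒪_{ℂ_F}♭` with `[x] − 1 ∈ (p, ξ)`, `k ≥ 1`, and a logarithm `L` of `[x]`
modulo `Fil^k` with `θ(L) = 0`: there are `N ∈ ℕ` and `a ∈ ℤ_p` with `p^N·L − a·t ∈ ξ^k B_dR⁺`. Chain: `log_p(x♯) = θ(L) = 0`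
(`IsLogModFil.hasSum_thetaBdR`) ⟹ `(x♯)^{p^N} = 1` (`exists_pow_prime_pow_eq_one_of_hasSum_log_zero`) ⟹ `x^{p^N} = ε^a`
(`exists_pow_eq_epsPow_of_untilt_pow_eq_one`) ⟹ `p^N·L` and `a·t` are both logarithms of `[x]^{p^N} = [ε^a]` ⟹ uniqueness modulo `Fil^k`.
This is `X ∩ Fil¹ = ℚ_p(1)` of the fundamental exact sequence, generatorwise. [cite: FontaineOuyang2022, §6.1] [cite: FontaineAsterisque223III, Exp. II §1.5.4] -/
theorem IsLogModFil.exists_pow_mul_sub_mul_tBdR_mem (hp : valuation F p < 1) {k : ℕ} (hk : 1 ≤ k) {x : PreTilt (integerC F) p}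
    (hx : (teichmuller p x : Ainf (p := p) F) - 1 ∈ Ideal.span {(p : Ainf (p := p) F), xi}) {L : BDeRhamPlus (integerC F) p}
    (hL : IsLogModFil k ((teichmuller p x : Ainf (p := p) F) - 1) L) (h0 : thetaBdR L = 0) :
    ∃ (N : ℕ) (a : ℤ_[p]), (p : BDeRhamPlus (integerC F) p) ^ N * L - qpToBdR (a : ℚ_[p]) * tBdR ∈
      Ideal.span {(xiBdR : BDeRhamPlus (integerC F) p) ^ k} := by
  have h1 : (1 : Ainf (p := p) F) + ((teichmuller p x : Ainf (p := p) F) - 1) = teichmuller p x := by ring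
  -- `log_p(x♯) = 0`
  have hsum := hL.hasSum_thetaBdR hp hk hx
  rw [h0, h1, thetaBdR_ainfToBdR_teichmuller] at hsum
  have hlt : ‖1 - ((PreTilt.untilt x : integerC F) : CompletedAlgClosure F)‖ < 1 := by
    have h := norm_one_sub_thetaBdR_lt_one hx
    rwa [h1, thetaBdR_ainfToBdR_teichmuller] at h
  -- `(x♯)^{p^N} = 1`, `x^{p^N} = ε^a`
  obtain ⟨N, hN⟩ := CompletedAlgClosure.exists_pow_prime_pow_eq_one_of_hasSum_log_zero hp hlt hsum
  have hN' : PreTilt.untilt x ^ p ^ N = 1 := Subtype.ext (by rw [SubmonoidClass.coe_pow, hN]; rfl)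
  obtain ⟨a, ha⟩ := PreTilt.exists_pow_eq_epsPow_of_untilt_pow_eq_one x N hN'
  -- `p^N · L` and `a · t` are logarithms of `[ε^a]`
  have hpow := hL.pow_sub_one hx (p ^ N)
  rw [h1, ← map_pow, ha, nsmul_eq_mul, Nat.cast_pow] at hpow
  exact ⟨N, a, hpow.sub_mem_span_xiBdR_pow (isLogModFil_teichmuller_epsPow k a)⟩

/-! ## §3 `θ` is onto `ℂ_F` up to powers of `p` -/

omit [Fact (¬ IsUnit (p : integerC F))] [IsAdicComplete (Ideal.span {(p : integerC F)}) (integerC F)] in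
/-- Principal units of `ℂ_F` are closed under powers, with `log(uⁿ) = n·log(u)` as `HasSum` identities.
[cite: NeukirchANT1999, Ch. II (5.4)] -/
theorem hasSum_log_pow_completedAlgClosure (hp : valuation F p < 1) {u : CompletedAlgClosure F} (hu : ‖1 - u‖ < 1)
    {a : CompletedAlgClosure F} (ha : HasSum (fun n : ℕ => -((1 - u) ^ (n + 1)) / (n + 1 : CompletedAlgClosure F)) a) (m : ℕ) :
    ‖1 - u ^ m‖ < 1 ∧ HasSum (fun n : ℕ => -((1 - u ^ m) ^ (n + 1)) / (n + 1 : CompletedAlgClosure F)) ((m : CompletedAlgClosure F) * a) := by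
  induction m with
  | zero =>
    refine ⟨by rw [pow_zero, sub_self, norm_zero]; exact one_pos, ?_⟩
    rw [Nat.cast_zero, zero_mul, pow_zero]
    convert hasSum_zero with n
    rw [sub_self, zero_pow (Nat.succ_ne_zero n), neg_zero, zero_div]
  | succ m ih =>
    obtain ⟨hm, hsum⟩ := ih
    have hu1 : ‖u‖ ≤ 1 := by
      have e : u = 1 + -(1 - u) := by ring
      rw [e]
      exact (IsUltrametricDist.norm_add_le_max _ _).trans (max_le (by rw [norm_one]) (by rw [norm_neg]; exact hu.le))
    refine ⟨?_, ?_⟩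
    · have e : (1 : CompletedAlgClosure F) - u ^ (m + 1) = (1 - u ^ m) + u ^ m * (1 - u) := by ring
      rw [e]
      refine (IsUltrametricDist.norm_add_le_max _ _).trans_lt (max_lt hm ?_)
      rw [norm_mul, norm_pow]
      exact (mul_le_of_le_one_left (norm_nonneg _) (pow_le_one₀ (norm_nonneg _) hu1)).trans_lt hu
    · have h := CompletedAlgClosure.hasSum_log_mul hp hm hu hsum ha
      rw [← pow_succ] at h
      convert h using 1
      push_cast; ring

omit [Fact (¬ IsUnit (p : integerC F))] [IsAdicComplete (Ideal.span {(p : integerC F)}) (integerC F)] in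
/-- **The `p^M`-power trick**: for a principal unit `u` of `ℂ_F`, `‖1 − u^{p^M}‖ ≤ ‖p‖` for some `M` (IUT `exists_norm_one_sub_pow_le` through the
rescaled norm of `PadicCompletedAlgClosure`). [cite: NeukirchANT1999, Ch. II (5.5)] -/
theorem exists_norm_one_sub_pow_prime_pow_le_completedAlgClosure (hp : valuation F p < 1) {u : CompletedAlgClosure F} (hu : ‖1 - u‖ < 1) :
    ∃ M : ℕ, ‖1 - u ^ p ^ M‖ ≤ ‖(p : CompletedAlgClosure F)‖ := by
  let u' : PadicCompletedAlgClosure F p hp := (PadicCompletedAlgClosure.toC hp).symm u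
  have hu' : ‖1 - u'‖ < 1 := by
    rw [PadicCompletedAlgClosure.norm_lt_one_iff, map_sub, map_one, RingEquiv.apply_symm_apply]; exact hu
  haveI : CharZero (CompletedAlgClosure F) := charZero_of_injective_algebraMap (algebraMap F (CompletedAlgClosure F)).injective
  have hp0 : 0 < ‖(p : PadicCompletedAlgClosure F p hp)‖ :=
    norm_pos_iff.2 (Nat.cast_ne_zero.2 (Fact.out : p.Prime).ne_zero)
  obtain ⟨M, hM⟩ := exists_norm_one_sub_pow_le p (PadicCompletedAlgClosure F p hp) hu' hp0
  refine ⟨M, ?_⟩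
  have h1 := (PadicCompletedAlgClosure.norm_le_iff hp hp0.le (1 - u' ^ p ^ M)).1 hM
  rw [map_sub, map_one, map_pow, RingEquiv.apply_symm_apply] at h1
  refine h1.trans (le_of_eq ?_)
  rw [PadicCompletedAlgClosure.norm_rpow_normExponent, map_natCast]

/-- ★★ **`θ` maps the logarithms onto `ℂ_F` up to `p`-powers**: for `k ≥ 1` and every `c ∈ ℂ_F` there are `N`, `x ∈ 𝒪_{ℂ_F}♭` with
`[x] − 1 ∈ (p, ξ)` and a logarithm `L` of `[x]` modulo `Fil^k` with `θ(L) = p^N · c` (`log` is onto a ball of `ℂ_F`, `♯` is onto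
`𝒪_{ℂ_F}`, `‖1 − u^{p^M}‖ ≤ ‖p‖` for `M ≫ 0`, and `θ(log[x]) = log_p(x♯)`). This is `θ(X) = ℂ_F` of the fundamental exact sequence,
generatorwise. [cite: FontaineOuyang2022, §6.1] [cite: FontaineAsterisque223III, Exp. II §1.5.4] -/
theorem exists_isLogModFil_thetaBdR_eq_pow_mul (hp : valuation F p < 1) {k : ℕ} (hk : 1 ≤ k) (c : CompletedAlgClosure F) :
    ∃ (N : ℕ) (x : PreTilt (integerC F) p) (L : BDeRhamPlus (integerC F) p),
      (teichmuller p x : Ainf (p := p) F) - 1 ∈ Ideal.span {(p : Ainf (p := p) F), xi} ∧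
      IsLogModFil k ((teichmuller p x : Ainf (p := p) F) - 1) L ∧ thetaBdR L = (p : CompletedAlgClosure F) ^ N * c := by
  haveI : CharZero (CompletedAlgClosure F) := charZero_of_injective_algebraMap (algebraMap F (CompletedAlgClosure F)).injective
  obtain ⟨r, hr, hlog⟩ := CompletedAlgClosure.exists_hasSum_log_eq_of_norm_le (F := F) hp
  -- scale `c` into the ball of radius `r`
  have hc1 : 0 < ‖c‖ + 1 := by positivity
  obtain ⟨N₁, hN₁⟩ := exists_pow_lt_of_lt_one (div_pos hr hc1) (norm_natCast_C_lt_one' (F := F) (p := p))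
  have hz : ‖(p : CompletedAlgClosure F) ^ N₁ * c‖ ≤ r := by
    rw [norm_mul, norm_pow]
    have h2 : ‖(p : CompletedAlgClosure F)‖ ^ N₁ * ‖c‖ ≤ ‖(p : CompletedAlgClosure F)‖ ^ N₁ * (‖c‖ + 1) :=
      mul_le_mul_of_nonneg_left (by linarith) (pow_nonneg (norm_nonneg _) _)
    refine h2.trans ?_
    have h3 := mul_lt_mul_of_pos_right hN₁ hc1
    rw [div_mul_cancel₀ _ hc1.ne'] at h3
    exact h3.le
  obtain ⟨u, hu, hsum⟩ := hlog _ hz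
  -- the `p^M`-power trick: `v = u^{p^M}` has `‖1 − v‖ ≤ ‖p‖`, `log v = p^M log u`
  obtain ⟨M, hM⟩ := exists_norm_one_sub_pow_prime_pow_le_completedAlgClosure hp hu
  obtain ⟨hv, hsumv⟩ := hasSum_log_pow_completedAlgClosure hp hu hsum (p ^ M)
  -- `v = x♯`
  have hv1 : ‖u ^ p ^ M‖ ≤ 1 := by
    have e : u ^ p ^ M = 1 + -(1 - u ^ p ^ M) := by ring
    rw [e]
    exact (IsUltrametricDist.norm_add_le_max _ _).trans (max_le (by rw [norm_one]) (by rw [norm_neg]; exact hv.le))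
  obtain ⟨x, hx⟩ := CompletedAlgClosure.exists_untilt_coe_eq (F := F) (p := p) hv1
  have hmem : (teichmuller p x : Ainf (p := p) F) - 1 ∈ Ideal.span {(p : Ainf (p := p) F), xi} := by
    rw [teichmuller_sub_one_mem_span_p_xi_iff, hx, ← norm_neg, neg_sub]; exact hM
  obtain ⟨L, hL⟩ := exists_isLogModFil hmem k
  refine ⟨M + N₁, x, L, hmem, hL, ?_⟩
  have h1 : (1 : Ainf (p := p) F) + ((teichmuller p x : Ainf (p := p) F) - 1) = teichmuller p x := by ring
  have hθ := hL.hasSum_thetaBdR hp hk hmem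
  rw [h1, thetaBdR_ainfToBdR_teichmuller, hx] at hθ
  rw [hθ.unique hsumv, Nat.cast_pow, pow_add, mul_assoc]

end GaloisContinuity

end Literature.NumberTheory.PAdicHodge

end
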